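import Literature.AlgebraicGeometry.Motives.LinesGenerateChowOneLinear
import Literature.AlgebraicGeometry.Motives.ProjectiveSpaceFieldPointsBijective
import Literature.AlgebraicGeometry.Resolution.VertexBlowupCharts
import Mathlib.Algebra.MvPolynomial.Funext
import HarnessLib

/-!
# Moving a rational point of `ℙⁿ_k` to the vertex `(0 : … : 0 : 1)`; rational points are dense

Topic `Literature/AlgebraicGeometry/Motives`. Pure proofs, no named facts. Two elementary facts
about `ℙⁿ_k = Literature.AlgebraicGeometry.Motives.projectiveSpace n k` used by the discharge of
`Motives.exists_fiberNet_smoothBase_nonempty` (`Motives/FiberNetExistence`), whose induction step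
(`Motives/FiberNetVertexStep`) blows `ℙᵐ⁺¹` up in the VERTEX `(0 : … : 0 : 1)`
(`Resolution.DeJong1996.vertex`, the normalisation of `Resolution/AlterationsLemma411Vertex`) and
needs that vertex to be moved into a given non-empty open set:

* `exists_iso_left_vertex_eq` — **`PGL_{n+1}(k)` moves the vertex to any rational point with
  non-vanishing last coordinate**: for `z ∈ kⁿ⁺¹` with `z_n ≠ 0` the invertible linear substitution
  `xⱼ ↦ xⱼ + zⱼ xₙ` (`j < n`), `xₙ ↦ zₙ xₙ` (`vertexSubst`, inverse `vertexSubstInv`) defines a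
  `k`-automorphism of `ℙⁿ_k` (`Motives/ProjectiveSpaceLinearSubst.substMap`, Hartshorne II 7.1.1)
  sending the vertex `[0 : … : 0 : 1]` to `[z]` (`pointOfVec_comp_substMap`: on points a
  substitution acts by `[w] ↦ [τ(w)]`);
* `exists_pointOfVec_pt_mem` — **over an infinite field the rational points with `z_n ≠ 0` are
  dense in `ℙⁿ_k`**: a non-empty open contains a basic open `D₊(G)`, `G ≠ 0` homogeneous
  (Mathlib `ProjectiveSpectrum.isTopologicalBasis_basic_opens`, `basicOpen_eq_union_of_projection`),
  and `G · xₙ ≠ 0` has a non-zero value `w` (`MvPolynomial.funext`), so `[w] ∈ D₊(G)`;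
* `exists_iso_left_vertex_mem` — hence for every non-empty open `U ⊆ ℙⁿ⁺¹_k` (`k` infinite) there
  is a `k`-automorphism `ε` of `ℙⁿ⁺¹_k` with `ε(vertex) ∈ U`.

## References

* R. Hartshorne, *Algebraic Geometry* (1977), II Example 7.1.1 (automorphisms of `ℙⁿ_k`),
  I Ex. 2.14. [Hartshorne1977]
-/

noncomputable section

open CategoryTheory AlgebraicGeometry MvPolynomial

universe u

namespace Literature.AlgebraicGeometry.Motives

namespace ProjectiveSpace

variable {k : Type u} [Field k] {n : ℕ}

attribute [local instance] MvPolynomial.gradedAlgebra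

/-! ## The substitution moving `e_last` to `z` -/

/-- The linear substitution `xⱼ ↦ xⱼ + zⱼ·x_last` (`j ≠ last`), `x_last ↦ z_last·x_last`; on points
(`substVec`) it is `w ↦ (wⱼ + zⱼ w_last)ⱼ, z_last w_last`, carrying `e_last` to `z`. [folklore] -/
def vertexSubst (z : Fin (n + 1) → k) : Fin (n + 1) → MvPolynomial (Fin (n + 1)) k := fun j =>
  if j = Fin.last n then C (z (Fin.last n)) * X (Fin.last n) else X j + C (z j) * X (Fin.last n)

/-- The inverse substitution `xⱼ ↦ xⱼ - (zⱼ/z_last)·x_last` (`j ≠ last`), `x_last ↦ z_last⁻¹·x_last`.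
[folklore] -/
def vertexSubstInv (z : Fin (n + 1) → k) : Fin (n + 1) → MvPolynomial (Fin (n + 1)) k := fun j =>
  if j = Fin.last n then C (z (Fin.last n))⁻¹ * X (Fin.last n)
  else X j - C (z j / z (Fin.last n)) * X (Fin.last n)

/-- `vertexSubst z` consists of linear forms. [folklore] -/
theorem isHomogeneous_vertexSubst (z : Fin (n + 1) → k) (j : Fin (n + 1)) :
    (vertexSubst z j).IsHomogeneous 1 := by
  unfold vertexSubst
  split_ifs
  · simpa using (isHomogeneous_C _ (z (Fin.last n))).mul (isHomogeneous_X k (Fin.last n))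
  · exact (isHomogeneous_X k j).add
      (by simpa using (isHomogeneous_C _ (z j)).mul (isHomogeneous_X k (Fin.last n)))

/-- `vertexSubstInv z` consists of linear forms. [folklore] -/
theorem isHomogeneous_vertexSubstInv (z : Fin (n + 1) → k) (j : Fin (n + 1)) :
    (vertexSubstInv z j).IsHomogeneous 1 := by
  unfold vertexSubstInv
  split_ifs
  · simpa using (isHomogeneous_C _ (z (Fin.last n))⁻¹).mul (isHomogeneous_X k (Fin.last n))
  · exact (isHomogeneous_X k j).sub
      (by simpa using (isHomogeneous_C _ (z j / z (Fin.last n))).mul (isHomogeneous_X k (Fin.last n)))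

/-- `σ_τ ∘ σ_{τ'} = id` for `τ = vertexSubst z`, `τ' = vertexSubstInv z` (`z_last ≠ 0`). [folklore] -/
theorem aeval_vertexSubst_vertexSubstInv (z : Fin (n + 1) → k) (hz : z (Fin.last n) ≠ 0)
    (p : MvPolynomial (Fin (n + 1)) k) : aeval (vertexSubst z) (aeval (vertexSubstInv z) p) = p := by
  have h : (aeval (vertexSubst z)).comp (aeval (vertexSubstInv z)) =
      AlgHom.id k (MvPolynomial (Fin (n + 1)) k) := by
    refine algHom_ext fun j => ?_
    simp only [AlgHom.comp_apply, aeval_X, AlgHom.id_apply, vertexSubstInv]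
    split_ifs with hj
    · subst hj
      simp only [map_mul, aeval_C, aeval_X, vertexSubst, if_true, algebraMap_eq]
      rw [← mul_assoc, ← C_mul, inv_mul_cancel₀ hz, C_1, one_mul]
    · simp only [map_sub, map_mul, aeval_C, aeval_X, vertexSubst, if_neg hj, if_true, algebraMap_eq]
      rw [← mul_assoc, ← C_mul, div_mul_cancel₀ _ hz]
      ring
  exact congrArg (fun f => f p) (congrArg DFunLike.coe h)

/-- `σ_{τ'} ∘ σ_τ = id` for `τ = vertexSubst z`, `τ' = vertexSubstInv z` (`z_last ≠ 0`). [folklore] -/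
theorem aeval_vertexSubstInv_vertexSubst (z : Fin (n + 1) → k) (hz : z (Fin.last n) ≠ 0)
    (p : MvPolynomial (Fin (n + 1)) k) : aeval (vertexSubstInv z) (aeval (vertexSubst z) p) = p := by
  have h : (aeval (vertexSubstInv z)).comp (aeval (vertexSubst z)) =
      AlgHom.id k (MvPolynomial (Fin (n + 1)) k) := by
    refine algHom_ext fun j => ?_
    simp only [AlgHom.comp_apply, aeval_X, AlgHom.id_apply, vertexSubst]
    split_ifs with hj
    · subst hj
      simp only [map_mul, aeval_C, aeval_X, vertexSubstInv, if_true, algebraMap_eq]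
      rw [← mul_assoc, ← C_mul, mul_inv_cancel₀ hz, C_1, one_mul]
    · simp only [map_add, map_mul, aeval_C, aeval_X, vertexSubstInv, if_neg hj, if_true, algebraMap_eq]
      rw [← mul_assoc, ← C_mul, ← div_eq_mul_inv]
      ring
  exact congrArg (fun f => f p) (congrArg DFunLike.coe h)

/-- On vectors, `vertexSubst z` carries `e_last = (0, …, 0, 1)` to `z`. [folklore] -/
theorem substVec_vertexSubst_single (z : Fin (n + 1) → k) :
    substVec (vertexSubst z) (Pi.single (Fin.last n) (1 : k)) = z := by
  funext j
  rw [substVec_apply, vertexSubst]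
  split_ifs with hj
  · subst hj
    simp
  · simp [Pi.single_eq_of_ne hj]

/-- `e_last ≠ 0`. [folklore] -/
theorem single_last_ne_zero : (Pi.single (Fin.last n) (1 : k) : Fin (n + 1) → k) ≠ 0 := by
  intro h
  have := congrFun h (Fin.last n)
  simp at this

/-- A vector with non-zero last coordinate is non-zero. [folklore] -/
theorem ne_zero_of_apply_last_ne_zero {z : Fin (n + 1) → k} (hz : z (Fin.last n) ≠ 0) : z ≠ 0 :=
  fun h => hz (by simp [h])

/-- **The projective linear transformation of `ℙⁿ_k` attached to `vertexSubst z`, as a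
`k`-automorphism** (an isomorphism in `Over (Spec k)`), for `z_last ≠ 0`.
[cite: Hartshorne1977, II Example 7.1.1] -/
def vertexSubstIso (z : Fin (n + 1) → k) (hz : z (Fin.last n) ≠ 0) :
    projectiveSpace n k ≅ projectiveSpace n k where
  hom := substMap (vertexSubst z) (isHomogeneous_vertexSubst z) (vertexSubstInv z)
    (isHomogeneous_vertexSubstInv z) (aeval_vertexSubst_vertexSubstInv z hz)
  inv := substMap (vertexSubstInv z) (isHomogeneous_vertexSubstInv z) (vertexSubst z)
    (isHomogeneous_vertexSubst z) (aeval_vertexSubstInv_vertexSubst z hz)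
  hom_inv_id := by
    ext : 1
    rw [Over.comp_left, substMap_left, substMap_left, Over.id_left]
    exact ProjectiveSpaceCells.substMapHom_comp_substMapHom _ _ _ _ _
      (aeval_vertexSubstInv_vertexSubst z hz)
  inv_hom_id := by
    ext : 1
    rw [Over.comp_left, substMap_left, substMap_left, Over.id_left]
    exact ProjectiveSpaceCells.substMapHom_comp_substMapHom _ _ _ _ _
      (aeval_vertexSubst_vertexSubstInv z hz)

/-- `[e_last] ≫ vertexSubstIso z = [z]` on `k`-points. [cite: Hartshorne1977, II Ex. 2.14] -/
theorem pointOfVec_single_comp_vertexSubstIso (z : Fin (n + 1) → k) (hz : z (Fin.last n) ≠ 0) :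
    pointOfVec k (Pi.single (Fin.last n) (1 : k)) single_last_ne_zero ≫ (vertexSubstIso z hz).hom =
      pointOfVec k z (ne_zero_of_apply_last_ne_zero hz) := by
  have h := pointOfVec_comp_substMap (vertexSubst z) (isHomogeneous_vertexSubst z) (vertexSubstInv z)
    (isHomogeneous_vertexSubstInv z) (aeval_vertexSubst_vertexSubstInv z hz)
    (Pi.single (Fin.last n) (1 : k)) single_last_ne_zero
    (by rw [substVec_vertexSubst_single]; exact ne_zero_of_apply_last_ne_zero hz)
  rw [vertexSubstIso, h]
  congr 1
  exact substVec_vertexSubst_single z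

end ProjectiveSpace

/-! ## The vertex is the rational point `[0 : … : 0 : 1]` -/

namespace ProjectiveSpace

open Literature.AlgebraicGeometry.Resolution

variable {k : Type u} [Field k] {d : ℕ}

attribute [local instance] MvPolynomial.gradedAlgebra

/-- The underlying point of the `k`-point `[0 : … : 0 : 1]` of `ℙᵈ⁺¹_k` is the vertex
`V₊(x₀, …, x_d)` of `Resolution.DeJong1996` (all `xᵢ`, `i ≤ d`, vanish at it:
`DeJong1996.eq_vertex_iff`). [folklore] -/
theorem pt_pointOfVec_single_last :
    @Eq (Proj (Segre.grading (Fin (d + 1 + 1)) k))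
      (pointOfVec k (Pi.single (Fin.last (d + 1)) (1 : k)) single_last_ne_zero).pt
      (DeJong1996.vertex d k) := by
  rw [DeJong1996.eq_vertex_iff]
  intro i
  have h := pt_pointOfVec_mem_basicOpen_X_iff (k := k) (Pi.single (Fin.last (d + 1)) (1 : k))
    single_last_ne_zero (Fin.castSucc i)
  by_contra hmem
  exact (h.mp hmem) (Pi.single_eq_of_ne (Fin.castSucc_lt_last i).ne _)

/-- **A `k`-automorphism of `ℙᵈ⁺¹_k` carrying the vertex to a prescribed rational point `[z]`
with `z_last ≠ 0`.** [cite: Hartshorne1977, II Example 7.1.1] -/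
theorem exists_iso_left_vertex_eq (z : Fin (d + 1 + 1) → k) (hz : z (Fin.last (d + 1)) ≠ 0) :
    ∃ ε : projectiveSpace (d + 1) k ≅ projectiveSpace (d + 1) k,
      ε.hom.left (DeJong1996.vertex d k) = (pointOfVec k z (ne_zero_of_apply_last_ne_zero hz)).pt := by
  refine ⟨vertexSubstIso z hz, ?_⟩
  have h1 := pt_pointOfVec_single_last (k := k) (d := d)
  have h2 := congrArg AlgPoints.pt (pointOfVec_single_comp_vertexSubstIso z hz)
  rw [← h2, ← h1]
  rfl

/-! ## Rational points are dense (infinite field) -/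

/-- **Over an infinite field, every non-empty open subset of `ℙᵈ⁺¹_k` contains a rational point
`[z]` with `z_last ≠ 0`.** A non-empty open contains some `D₊(G)` with `G ≠ 0` homogeneous of
positive degree (basic opens form a basis and `D₊(f) = ⋃ᵢ D₊(fᵢ)` over the homogeneous
components; a component of degree `0` not vanishing at a point is a non-zero constant, and then
`D₊ = ℙ`), and the non-zero polynomial `G · x_last` has a non-zero value (`MvPolynomial.funext`).
[cite: Hartshorne1977, I Ex. 2.14] -/
theorem exists_pointOfVec_pt_mem [Infinite k] (U : ((projectiveSpace (d + 1) k).left).Opens)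
    (hU : (U : Set (projectiveSpace (d + 1) k).left).Nonempty) :
    ∃ (z : Fin (d + 1 + 1) → k) (hz : z (Fin.last (d + 1)) ≠ 0),
      (pointOfVec k z (ne_zero_of_apply_last_ne_zero hz)).pt ∈ U := by
  classical
  let 𝒜 := MvPolynomial.homogeneousSubmodule (Fin (d + 1 + 1)) k
  -- respell `U` as a set of points of `ProjectiveSpectrum 𝒜` (definitionally the same space)
  let V : Set (ProjectiveSpectrum 𝒜) := (U : Set (projectiveSpace (d + 1) k).left)
  have hVo : IsOpen V := U.isOpen
  have hV : V.Nonempty := hU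
  suffices h : ∃ (z : Fin (d + 1 + 1) → k) (hz : z (Fin.last (d + 1)) ≠ 0),
      ((pointOfVec k z (ne_zero_of_apply_last_ne_zero hz)).pt : ProjectiveSpectrum 𝒜) ∈ V from h
  obtain ⟨u, hu⟩ := hV
  -- a basic open `D₊(f) ∋ u` inside `V`, and a homogeneous component `G` of `f` not vanishing at `u`
  obtain ⟨_, ⟨f, rfl⟩, huf, hfU⟩ :=
    (ProjectiveSpectrum.isTopologicalBasis_basic_opens 𝒜).exists_subset_of_mem_open hu hVo
  have huf' : u ∈ ((⨆ i : ℕ, ProjectiveSpectrum.basicOpen 𝒜 (GradedRing.proj 𝒜 i f) :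
      TopologicalSpace.Opens (ProjectiveSpectrum 𝒜)) : Set (ProjectiveSpectrum 𝒜)) := by
    rw [← ProjectiveSpectrum.basicOpen_eq_union_of_projection]
    exact huf
  rw [TopologicalSpace.Opens.coe_iSup, Set.mem_iUnion] at huf'
  obtain ⟨i, hui⟩ := huf'
  set G := GradedRing.proj 𝒜 i f with hG
  have hGmem : G ∈ 𝒜 i := by
    rw [hG, GradedRing.proj_apply]
    exact SetLike.coe_mem _
  have hGhom : G.IsHomogeneous i := (mem_homogeneousSubmodule i G).mp hGmem
  have hGU : ∀ x : ProjectiveSpectrum 𝒜, x ∈ (ProjectiveSpectrum.basicOpen 𝒜 G : Set _) → x ∈ V := by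
    intro x hx
    apply hfU
    change x ∈ (ProjectiveSpectrum.basicOpen 𝒜 f : Set _)
    rw [ProjectiveSpectrum.basicOpen_eq_union_of_projection, TopologicalSpace.Opens.coe_iSup,
      Set.mem_iUnion]
    exact ⟨i, hx⟩
  have hui' : G ∉ u.asHomogeneousIdeal := (ProjectiveSpectrum.mem_basicOpen 𝒜 _ _).mp hui
  have hG0 : G ≠ 0 := by
    intro h0
    exact hui' (by rw [h0]; exact Ideal.zero_mem _)
  by_cases hi : i = 0
  · -- `G` is a non-zero constant: `D₊(G) = ⊤`, take `[e_last]`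
    subst hi
    refine ⟨Pi.single (Fin.last (d + 1)) 1, by simp, hGU _ ?_⟩
    rw [SetLike.mem_coe, ProjectiveSpectrum.mem_basicOpen]
    intro hmem
    -- a relevant homogeneous prime containing a non-zero constant: contradiction
    have hC : G = C (coeff 0 G) :=
      (totalDegree_eq_zero_iff_eq_C (p := G)).mp (Nat.le_zero.mp (by simpa using hGhom.totalDegree_le))
    have hc : coeff 0 G ≠ 0 := fun h => hG0 (by rw [hC, h, C_0])
    have hunit : IsUnit G := by rw [hC]; exact (isUnit_iff_ne_zero.mpr hc).map C
    exact ((pointOfVec k (Pi.single (Fin.last (d + 1)) (1 : k)) single_last_ne_zero).pt :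
        ProjectiveSpectrum 𝒜).isPrime.ne_top (Ideal.eq_top_of_isUnit_mem _ hmem hunit)
  · -- `G · x_last ≠ 0` has a non-zero value `w`
    have hi' : 0 < i := Nat.pos_of_ne_zero hi
    have hne : G * X (Fin.last (d + 1)) ≠ 0 := mul_ne_zero hG0 (X_ne_zero _)
    obtain ⟨w, hw⟩ : ∃ w : Fin (d + 1 + 1) → k, eval w (G * X (Fin.last (d + 1))) ≠ 0 := by
      by_contra! h
      exact hne (MvPolynomial.funext fun w => by rw [h w, map_zero])
    rw [map_mul, eval_X, mul_ne_zero_iff] at hw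
    refine ⟨w, hw.2, hGU _ ?_⟩
    exact (pt_pointOfVec_mem_basicOpen_iff (k := k) w (ne_zero_of_apply_last_ne_zero hw.2) hi'
      hGmem).mpr hw.1

/-- **For every non-empty open `U ⊆ ℙᵈ⁺¹_k` over an infinite field there is a `k`-automorphism
`ε` of `ℙᵈ⁺¹_k` moving the vertex `(0 : … : 0 : 1)` into `U`.** [cite: Hartshorne1977, II Example 7.1.1] -/
theorem exists_iso_left_vertex_mem [Infinite k] (U : ((projectiveSpace (d + 1) k).left).Opens)
    (hU : (U : Set (projectiveSpace (d + 1) k).left).Nonempty) :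
    ∃ ε : projectiveSpace (d + 1) k ≅ projectiveSpace (d + 1) k, ε.hom.left (DeJong1996.vertex d k) ∈ U := by
  obtain ⟨z, hz, hzU⟩ := exists_pointOfVec_pt_mem U hU
  obtain ⟨ε, hε⟩ := exists_iso_left_vertex_eq z hz
  exact ⟨ε, hε ▸ hzU⟩

end ProjectiveSpace

end Literature.AlgebraicGeometry.Motives

end
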